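import Mathlib
import HarnessLib
import Summits.HubbardSuperconductivity.HubbardSuperconductivity.Theorems.KLProgrammeKLRegimeEngineTowerLevStepLinkUniformFKlEng
import Summits.HubbardSuperconductivity.HubbardSuperconductivity.Theorems.KLProgrammeKLRegimeEngineTowerLevZSuccOfBlockBounds
import Summits.HubbardSuperconductivity.HubbardSuperconductivity.Theorems.KLProgrammeKLRegimeEngineTowerLevLawOfRowsFTokX

/-!
# Route `KLProgramme` — crux K3 ENGINE (stmt-HubbardSuperconductivity-20437), stub (b) v2, THE LEVELS PACKAGE (ℓ): «(ℓ)-REKEY-ROWS» LINK 1 — the floor-keyed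
# levelled law of the re-based tower with the Z-invariant, the Chernoff export and the smallness rows, KEYED ON THE BASE DATUM AS ROWS (no grid step at
# `(Λ_d, F_{d−1})`) (cell gate-hubbard-kl, seat gate-hubbard-kl-p3 g22, pen (R359)(A); the rows-twin of p4 g20's `klTowerBLevF_le_law_lev_of_blocks_ZX`
# (…TowerLevLawFOfBlocksZX, p687569): `…TowerLevLawOfRowsFTokX.klTowerBLevF_le_law_lev_of_doors_of_le_B_tokX` (k3c3-p2 g16) at the token
# `Zk k := (Z^{K}_{Λ_{dk}} ≠ 0)` ∘ { `levLawF_hstep_of_blockBounds_tok`, `towerZ_succ_of_blockBounds` (k3c2-p3 g14) }, with `Z^{K}_{Λ_d} ≠ 0` a BINDER)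

WHY.  `klTowerBLevF_le_law_lev_of_blocks_ZX` reads the tower's base datum (`𝒱_d` at `F_{d−1}`) AND the base partition function `Z^K_{Λ_d} ≠ 0` from p3's weighted
grid step at `(Λ_d, F_{d−1})` — whose weighted overlap rows of `E(F_{d−1}[K_n])·S_{4M}` are in the located class (p3 g21, STATUS l.10537).  The Nb-keyed law
`klTowerBLevF_le_law_lev_of_doors_of_le_B_tokX` takes the base datum as ROWS (`N_b ≥ 0`, `hcar`, `hlawb : N_b t p / klLevUnitF … t p (d−1) ≤ A_b′·λ^{p−1}·Q_b^p`,
`A_b′ = A_b/B²`, `A_b > 0`), which p3 g22's `baseLawF_blockZeroF_klEng[_of_wgridStep]` (…TowerBlockZeroBaseFKlEng) supplies on `K_n` from the LEVEL-`0` datum with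
`N_b := klTowerMeasLev … d 1`; so this file re-keys p4's composition on it: the binder list of `…_of_blocks_ZX` with the grid-step group (`jw κ αw ρ θ crw ccw`,
`nV cF cg Ag Pg`, `Ab = 2^{7(d−1)}Ag/Klam²`, `Qb = Pg/8^{d−1}`) REPLACED by `_of_le_B_tokX`'s base-row group and ONE new binder `Z^{K}_{Λ_d} ≠ 0`; the link data, the
six pinned names, the (I5)-F choices, blocking, `B ≥ B₀`, imports, cell and doors, and the four-part conclusion, are byte-identical.

* **`klTowerBLevF_le_law_lev_of_blocks_ZX_rows`**.
Composition of landed theorems only; nothing about the model is asserted beyond them; nothing asserts (ℓ), any stub, K3 or superconductivity.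
References: BGM 2006 §2.8 (2.76)–(2.84), (2.93)–(2.98), §3 (3.2)–(3.8) [cite: BenfattoGiulianiMastropietro2006].
-/

noncomputable section

namespace Summit.HubbardSuperconductivity.HubbardSuperconductivity.Theorems.EngineV8

set_option linter.dupNamespace false -- summit = problem name (single-conjunct summit), D-0017

open Classical
open Real Finset Literature.MathematicalPhysics.QuantumLattice Literature.Probability.LatticeModels GrassmannAlgebra
open Literature.Probability.LatticeModels.BattleFederbush
open Literature.MathematicalPhysics.QuantumLattice.FermiRG
open Summit.HubbardSuperconductivity.HubbardSuperconductivity.Theorems.KLProgrammeLegKernels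
open Summit.HubbardSuperconductivity.HubbardSuperconductivity.Theorems.KLRegimeSplit
open Summit.HubbardSuperconductivity.HubbardSuperconductivity.Theorems.KLRegimeWick
open Summit.HubbardSuperconductivity.HubbardSuperconductivity.Theorems.TorusFourierL2
open Summit.HubbardSuperconductivity.HubbardSuperconductivity.Theorems.DispersionFlow

variable {L M : ℕ} [NeZero L] [NeZero M]

/-- **THE FLOOR-KEYED RE-BASED LEVELLED TOWER LAW WITH THE READ-OUT EXPORTS, BASE DATUM AS ROWS** («(ℓ)-REKEY-ROWS» link 1; rows-twin of
`klTowerBLevF_le_law_lev_of_blocks_ZX`): base rows `Nb/hcar/hlawb` (`0 < Ab`, `Ab' = Ab/B²`) and `Z^{K}_{Λ_d} ≠ 0` as binders instead of the `(Λ_d, F_{d−1})`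
grid step; every other binder and the conclusion `(∀ k ≤ Kb, Z^{K}_{Λ_{dk}} ≠ 0) ∧ (law) ∧ (Chernoff export) ∧ (smallness rows)` verbatim.
[cite: BenfattoGiulianiMastropietro2006, §2.8 (2.83), (2.93)-(2.98), §3 (3.2)-(3.8)] -/
theorem klTowerBLevF_le_law_lev_of_blocks_ZX_rows :
    ∃ C₁ C₂ : ℝ, 0 < C₁ ∧ 0 < C₂ ∧ ∀ R : RenConsts, R.WF2 → ∃ c₃' : ℝ, 0 < c₃' ∧ ∃ U₀' : ℝ, 0 < U₀' ∧
      ∀ (P : SplitConsts) (c : ℝ), P.WF → 0 < c → c ≤ klEngC₃6 P R → c ≤ c₃' →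
      ∀ μ ∈ klWindowC, ∀ U : ℝ, 0 < U → U ≤ klEngU₀9 P R c → U ≤ U₀' → ∀ β : ℝ, klBetaMin ≤ β → β ≤ Real.exp (c / U ^ 2) →
      ∀ K : TrigPolyC4v, FrameOK R U (nScales β) μ K → ∀ (L M : ℕ) [NeZero L] [NeZero M],
      klEngL₃ β U ≤ L → klEngM₃ β U L ≤ M → ∀ d Kb D : ℕ, 2 ≤ d → d * Kb - 1 ≤ nScales β + 1 → 3 ≤ D →
      ∀ (cc : ℝ) (n j : ℕ), IsKLRegime U cc (-(n : ℤ)) → j ≤ n →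
      ∀ (B Ab Qb ι₂ X : ℝ), 1 ≤ B → 0 < Ab → 0 ≤ Qb → 0 ≤ ι₂ → 0 ≤ X →
      -- the B-discounted data (equational binders)
      ∀ (Ab' ι₂' X' : ℝ), Ab' = Ab / B ^ 2 → ι₂' = ι₂ / B → X' = X / B ^ 2 →
      -- the BASE DATUM AS ROWS at the family `F_{d−1}` and its unit law in the discounted shape, at `λ = B·ε_j` (NO grid step)
      ∀ Nb : Fin 5 → ℕ → ℝ, (∀ t p, 0 ≤ Nb t p) →
        (∀ (t : Fin 5) (p : ℕ) (Ωe' : Fin (2 * p) → Option (SectorLeg (sectorCount (d - 1)))), levelCount Ωe' = (t : ℕ) + 1 →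
          klLevNormOf L M β μ K (d - 1) (2 * p) (klTowerInput L M β U μ K d 1) Ωe' ≤ Nb t p) →
        (∀ (t : Fin 5) (p : ℕ), 3 ≤ p → Nb t p / klLevUnitF β M t p (d - 1) ≤ Ab' * (B * epsCoupling P U j) ^ (p - 1) * Qb ^ p) →
      -- the partition function at the tower's base `Λ_d` (a binder; on `K_n` from `Z^{K_n}_{Λ_1} ≠ 0` and the block-0 kit guard, or E1's Z-chain)
      hubbardEffPartitionFnCT L M β U μ 0 K (klScale klE0 d) ≠ 0 →
      -- the floor LINK data («(ℓ)-LINK-UNIFORM-F», k3c2-p3 g14): per-block Gram, decay and analysis-overlap rows at k-free bounds (NO partition function)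
      ∀ (κb αb crb ccb : ℝ), 0 < κb → 0 < αb → 0 < crb → 0 < ccb →
      ∀ (κl αl : ℕ → ℝ), (∀ k, 1 ≤ k → k < Kb → 0 < κl k) → (∀ k, 1 ≤ k → k < Kb → κl k ^ 2 * (8 : ℝ) ^ (d * k) ≤ κb ^ 2) →
      (∀ k, 1 ≤ k → k < Kb → αl k ≤ αb * (4 : ℝ) ^ (d * k)) →
      (∀ k, 1 ≤ k → k < Kb → IsGramBoundedR ((sectorSubMatrix L M β (bgmFatMultiplier L M klE0 β (nambuXiCT L μ K) (d * k - 1))).transpose *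
        hubbardCovSliceCT L M β μ 0 K (klScale klE0 (d * (k + 1))) (klScale klE0 (d * k)) *
          sectorSubMatrix L M β (bgmFatMultiplier L M klE0 β (nambuXiCT L μ K) (d * k - 1))) (κl k)) →
      (∀ k, 1 ≤ k → k < Kb → ∀ X, ∑ Y, ‖((sectorSubMatrix L M β (bgmFatMultiplier L M klE0 β (nambuXiCT L μ K) (d * k - 1))).transpose *
        hubbardCovSliceCT L M β μ 0 K (klScale klE0 (d * (k + 1))) (klScale klE0 (d * k)) *
          sectorSubMatrix L M β (bgmFatMultiplier L M klE0 β (nambuXiCT L μ K) (d * k - 1))) X Y‖ ≤ αl k) →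
      (∀ k, 1 ≤ k → k < Kb → ∀ Y, ∑ X, ‖((sectorSubMatrix L M β (bgmFatMultiplier L M klE0 β (nambuXiCT L μ K) (d * k - 1))).transpose *
        hubbardCovSliceCT L M β μ 0 K (klScale klE0 (d * (k + 1))) (klScale klE0 (d * k)) *
          sectorSubMatrix L M β (bgmFatMultiplier L M klE0 β (nambuXiCT L μ K) (d * k - 1))) X Y‖ ≤ αl k) →
      (∀ k, 1 ≤ k → k < Kb → ∀ X'', ∑ X', ‖(sectorAnalysisMatrix L M β (klAnisoFamily L M β μ K klE0 (d * k)) *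
        sectorSubMatrix L M β (bgmFatMultiplier L M klE0 β (nambuXiCT L μ K) (d * k - 1))) X'' X'‖ ≤ crb) →
      (∀ k, 1 ≤ k → k < Kb → ∀ X', ∑ X'', ‖(sectorAnalysisMatrix L M β (klAnisoFamily L M β μ K klE0 (d * k)) *
        sectorSubMatrix L M β (bgmFatMultiplier L M klE0 β (nambuXiCT L μ K) (d * k - 1))) X'' X'‖ ≤ ccb) →
      (∀ k, 1 ≤ k → k < Kb → Fintype.card (SpaceTimeIdx L M × SectorLeg (sectorCount (d * k - 1))) / 2 ≤ D) →
      -- the law's six names PINNED by the link (equational binders), and the import `ι₁`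
      ∀ (W Z σ Φ ψ τ ι₁ : ℝ), W = 64 * (27 : ℝ) ^ 4 * exp 2 * crb / ccb → Z = exp 4 * ccb ^ 2 * imagTimeWeight β M ^ 2 / 8 →
        σ = κb ^ 2 / (exp 4 * ccb ^ 2) → Φ = 9 * αb * ccb / ((27 : ℝ) ^ 5 * exp 1 * κb ^ 2 * crb) → ψ = exp 4 * ccb ^ 2 / κb ^ 2 →
        τ = exp 2 * κb ^ 2 / ccb ^ 2 → 0 ≤ ι₁ →
      ∀ (ρk Q' Q κA Yb Y A A' ι₃ : ℝ), ρk = max 4 (2 * τ * ψ) → Q' = Z * Qb + 1 → Q = ρk * Q' →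
        κA = W * ((27 : ℝ) ^ 5 * (C₁ / C₂) * (8 : ℝ) ^ (d - 1)) →
        Yb = ι₂ / (2 * Q') + W * Z ^ 3 * X / (4 * Q' ^ 2) + (W * (27 : ℝ) ^ 5 * Ab + κA * Ab) * Q' / 2 →
        Y = ι₂' / (2 * Q') + W * Z ^ 3 * X' / (4 * Q' ^ 2) + (W * (27 : ℝ) ^ 5 * Ab' + κA * Ab') * Q' / 2 →
        A = 2 * Y * (1 - ((2 : ℝ) ^ d)⁻¹) / (κA * Q') →
        A' = (W * (27 : ℝ) ^ 5 * Ab' + κA * Ab') + 2 * Y / Q' → ι₃ = W * Z ^ 3 * X' + A' * Q' ^ 3 →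
      max 1 Z * C₂ ^ 2 * max 4 (2 * τ * ψ) ≤ (2 : ℝ) ^ (d - 1) →
      max 1 (max (8 * Φ * τ * Yb) (128 * exp 1 * ψ ^ 3 * τ ^ 4 * Φ * κA * Yb / ((1 - ((2 : ℝ) ^ d)⁻¹) * ρk ^ 3))) ≤ B →
      (∀ k, 1 ≤ k → k < Kb → W * Z ^ 1 * klTowerMuLevF L M β U μ K d k 1 ≤ ι₁ * (B * epsCoupling P U j)) →
      (∀ k, 1 ≤ k → k < Kb → W * Z ^ 2 * klTowerMuLevF L M β U μ K d k 2 ≤ ι₂' * (B * epsCoupling P U j)) →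
      (∀ k, 2 ≤ k → k ≤ Kb → klTowerMuLevAtF L M β U μ K d 0 k 3 ≤ X' * (B * epsCoupling P U j) ^ 2) →
      U ≤ min 1 (min (1 / (8 * σ * Q' + 1)) (min (1 / (2 * exp 1 * τ * Q' + 1)) (min (1 / (4 * Φ * τ * ι₁ + 1))
        (min (1 / (2 * (Φ * (exp 1 * τ * ι₁ + (exp 1 * τ) ^ 2 * ι₂' + (exp 1 * τ) ^ 3 * ι₃ + A' * (exp 1 * τ * Q') ^ 2 / 2)) + 1))
          (min (A * Q ^ 3 / (16 * σ * Q' * A' * (4 * Q') ^ 3 + A * Q ^ 3))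
            (A * Q ^ 3 / (16 * exp 1 * ψ * (2 * τ * ψ * Q') ^ 2 * Φ * τ ^ 2 * ι₁ ^ 2 + A * Q ^ 3))))))) / (2 * B * P.Klam + 1) →
      cc ≤ min 1 (min (1 / (8 * σ * Q' + 1)) (min (1 / (2 * exp 1 * τ * Q' + 1)) (min (1 / (4 * Φ * τ * ι₁ + 1))
        (min (1 / (2 * (Φ * (exp 1 * τ * ι₁ + (exp 1 * τ) ^ 2 * ι₂' + (exp 1 * τ) ^ 3 * ι₃ + A' * (exp 1 * τ * Q') ^ 2 / 2)) + 1))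
          (min (A * Q ^ 3 / (16 * σ * Q' * A' * (4 * Q') ^ 3 + A * Q ^ 3))
            (A * Q ^ 3 / (16 * exp 1 * ψ * (2 * τ * ψ * Q') ^ 2 * Φ * τ ^ 2 * ι₁ ^ 2 + A * Q ^ 3))))))) * Real.log 4 / (2 * B * P.Klam + 1) →
      (∀ k, 1 ≤ k → k ≤ Kb → hubbardEffPartitionFnCT L M β U μ 0 K (klScale klE0 (d * k)) ≠ 0) ∧
      (∀ k, 2 ≤ k → k ≤ Kb → ∀ (t : Fin 5) (p : ℕ), 3 ≤ p → p ≤ D →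
        klTowerBLevF L M β U μ K d t k p ≤ A * (B * epsCoupling P U j) ^ (p - 1) * Q ^ p) ∧
      (∀ k, 1 ≤ k → k ≤ Kb →
        (∀ m, 4 ≤ m → m ≤ D → W * Z ^ m * klTowerMuLevF L M β U μ K d k m ≤ A' * (B * epsCoupling P U j) ^ (m - 1) * Q' ^ m) ∧
        (3 ≤ D → W * Z ^ 3 * klTowerMuLevF L M β U μ K d k 3 ≤ ι₃ * (B * epsCoupling P U j) ^ 2)) ∧
      (4 * σ * (B * epsCoupling P U j) * Q' < 1 ∧ 2 * (B * epsCoupling P U j) * τ * Q' ≤ 1 ∧ exp 1 * τ * (B * epsCoupling P U j) * Q' < 1 ∧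
        Φ * (τ * (ι₁ * (B * epsCoupling P U j) + ι₂' / (2 * Q') + ι₃ / (4 * Q' ^ 2) + A' * Q' / 4)) < 1 ∧
        Φ * (exp 1 * τ * (ι₁ * (B * epsCoupling P U j)) + (exp 1 * τ) ^ 2 * (ι₂' * (B * epsCoupling P U j)) + (exp 1 * τ) ^ 3 * (ι₃ * (B * epsCoupling P U j) ^ 2) +
          A' * (exp 1 * τ * Q') * ((exp 1 * τ * (B * epsCoupling P U j) * Q') ^ 3 / (1 - exp 1 * τ * (B * epsCoupling P U j) * Q'))) < 1) := by
  obtain ⟨C₁, C₂, hC₁, hC₂, h⟩ := klTowerBLevF_le_law_lev_of_doors_of_le_B_tokX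
  refine ⟨C₁, C₂, hC₁, hC₂, fun R hR2 => ?_⟩
  obtain ⟨c₃, hc₃, U₀, hU₀, h'⟩ := h R hR2
  refine ⟨c₃, hc₃, U₀, hU₀, ?_⟩
  intro P c hP hc hc6 hc₃' μ hμ U hU hU9 hU₀' β hβmin hβc K hK L M _ _ hL3 hM3 d Kb D hd hKbN hD cc n j hreg hj B Ab Qb ι₂ X hB hAb hQb hι₂ hX
    Ab' ι₂' X' hAb' hι₂' hX' Nb hNb0 hcar hlawb hZd
    κb αb crb ccb hκb hαb hcrb hccb κl αl hκl hκκb hααb hGBl hrowl hcoll hrowl' hcoll' hDl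
    W Z σ Φ ψ τ ι₁ hW hZ hσ hΦ hψ hτ hι₁ ρk Q' Q κA Yb Y A A' ι₃ hρk hQ' hQ hκA hYb hY hA hA' hι₃ hblock hBle himp₁ himp₂ hcell hUdoor hcdoor
  have hβ : 0 < β := KLRegimeSplit.pos_of_klBetaMin_le hβmin
  have hM0 : (0 : ℝ) < M := Nat.cast_pos.2 (Nat.pos_of_ne_zero (NeZero.ne M))
  have hε : 0 < imagTimeWeight β M := by unfold imagTimeWeight; positivity
  have hWpos : 0 < W := by rw [hW]; positivity
  have hZpos : 0 < Z := by rw [hZ]; positivity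
  have hσnn : 0 ≤ σ := by rw [hσ]; positivity
  have hΦnn : 0 ≤ Φ := by rw [hΦ]; positivity
  have hψnn : 0 ≤ ψ := by rw [hψ]; positivity
  have hτpos : 0 < τ := by rw [hτ]; positivity
  -- the three discharges: tokenised floor step and Z-step from the link data, base value from the weighted grid step
  have hstep := levLawF_hstep_of_blockBounds_tok hβ U μ K hd Kb hκb hαb hcrb hccb κl αl hκl hκκb hααb hGBl hrowl hcoll hrowl' hcoll'
    hDl hW hZ hσ hτ hψ hΦ
  have hZsucc := towerZ_succ_of_blockBounds hβ U μ K hd Kb hκb hαb hcrb hccb κl αl hκl hκκb hααb hGBl hrowl hcoll hrowl' hcoll'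
    hDl hW hZ hσ hτ hψ hΦ
  have hZ1 : hubbardEffPartitionFnCT L M β U μ 0 K (klScale klE0 (d * 1)) ≠ 0 := by
    rw [Nat.mul_one]; exact hZd
  exact h' P c hP hc hc6 hc₃' μ hμ U hU hU9 hU₀' β hβmin hβc K hK L M hL3 hM3 d Kb D hd hKbN hD cc n j hreg hj B Ab Qb ι₂ X hB hAb hQb hι₂ hX
    Ab' ι₂' X' hAb' hι₂' hX' Nb hNb0 hcar hlawb
    W Z σ Φ ψ τ ι₁ hWpos hZpos hσnn hΦnn hψnn hτpos hι₁ ρk Q' Q κA Yb Y A A' ι₃ hρk hQ' hQ hκA hYb hY hA hA' hι₃ hblock hBle himp₁ himp₂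
    hcell (fun k => hubbardEffPartitionFnCT L M β U μ 0 K (klScale klE0 (d * k)) ≠ 0) hZ1 hZsucc hstep hUdoor hcdoor

end Summit.HubbardSuperconductivity.HubbardSuperconductivity.Theorems.EngineV8

end
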